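import Literature.IUT.HodgeArakelov.BadPrimeGaussianMonoidsCohomologyModelSectionsProofs

/-!
# [IUTchII] Cor 3.5 (ii) "⥤" WITHOUT the [AbsTopIII] interface: the Galois clause from the Kummer map of a
# `Π`-module of constants (`Ψ_cns := κ(𝒪^▷)`, `κ` equivariant) — generic over any `ThetaEnvData`, then at the label-wise
# cohomology model (proof-only; prepares the instantiation at the GENUINE record `thetaEnvRecordKummer`)

S. Mochizuki, *Inter-universal Teichmüller theory II*, kurims Dec-2020 manuscript: Prop 3.1 (ii) p. 88 ("`Ψ_cns(M^Θ_*) :=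
M_TM(M^Θ_*)` … naturally isomorphic to `O^▷_{F̄_v}` … equipped with a natural conjugation action"), Cor 3.5 (i)(ii) pp. 94–95,
Rmk 3.5.2 (iii) p. 98 (conjugate synchronization "arises from a `Δ_X(M^Θ_*)`-outer action": the GEOMETRIC fundamental group acts
trivially on the constants) [cite: Mochizuki2012, Cor 3.5 (ii) p.95]. Claim key DISPUTED (D-0012). PROOF-ONLY companion
(abc-iut cell, layer L6, seat abc-iut-w4-d004 gen 2; node **IUTchII:Cor3.5(ii)**, Galois clause). NO definition, NO `Prop` fact.

The landed assemblies of the Galois clause (`…SyncMonoidProofs`, `…CohomologyModelProofs2`, `…SectionsProofs`) take the Kummer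
data through abc-iut-L6-t1's [AbsTopIII] interface `AbsTopMonoids` (`κ : A.MTM Pc →* E.H`, `actMTM`), which has no genuine
instance yet (NV-L6 register: B9 routed to L4). THIS FILE re-derives the same chain from a Kummer map of an ARBITRARY
`Π`-module of constants — the shape of abc-iut-w4-d007's `h1LimKummerOn` at the genuine record: a `Π`-stable submonoid `O` of
a `Π`-module `A` ("`𝒪^▷_{k̄} ≤ k̄ˣ`"), `κ : O →* E.H` with `Ψ_cns = κ(O)` and `κ(σ • m) = conj_σ (κ m)`, and a subgroup `Δ ≤ Π`
acting TRIVIALLY on `O` (the geometric fundamental group; the Galois action on `k̄` factors through `Π ↠ G_k`):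
* `constantMonoid_conj_mem`, `units_conj_mem` — `Ψ_cns` and `M^×_TM` are conjugation-stable;
* `conj_eq_of_inv_mul_mem` / `sync_units_of_sections_kummer` — conjugate synchronization of the constants: sections
  `s_t` agreeing modulo `Δ` act label-independently on `Ψ_cns ⊇ M^×_TM` (Rmk 3.5.2 (iii));
* `mrange_pi_diagonalStable'_ofKummerAction` — **the Galois clause** (restrictions out of `M^×_TM · θ^ℕ`, diagonal
  stability of `Ψ_ξ`) from: the Kummer action data, `hs`, `hfix`, `hr` (abc-iut-w5-d100's schema
  `mrange_pi_diagonalStable_submonoid` + abc-iut-w4-d004's `sync_splitMonoid` / `splitMonoid_conjStable`);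
* `mrange_pi_diagonalStable'_ofKummerAction_labelwise` — the same at the LABEL-WISE cohomology model
  (`…SectionsProofs`): `hr`, `hfix` discharged, `hs` from "the `s_t` are sections of an augmentation `q` whose kernel acts
  trivially on `O`" — residual = Kummer action data + identification `(j, ψ)` + sections data + `θ` top-level.

Nothing here asserts a disputed claim or takes a side on [IUTchIII] Cor 3.12; typed ≠ proved ≠ endorsed.
-/

namespace Literature.IUT.HodgeArakelov

namespace BadPrimeGaussianMonoids

open Literature.AnabelianGeometry.EtaleTheta CohomologySystemOfContH1 TemperedThetaMonoids

universe u v w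

/-! ### 1. Constants from an equivariant Kummer map of a `Π`-module -/

section KummerAction

variable {Q : Type u} [Group Q] (E : TemperedThetaMonoids.ThetaEnvData.{u, v} Q)
  {A : Type w} [CommGroup A] [MulDistribMulAction Q A] (O : Submonoid A)
  (hO : ∀ (σ : Q) (b : A), b ∈ O → σ • b ∈ O) (κ : O →* E.H)

/-- `Ψ_cns = κ(O)` is conjugation-stable when `κ` is equivariant ("equipped with a natural conjugation action",
Prop 3.1 (ii)). [cite: Mochizuki2012, Prop 3.1 (ii) p.88] -/
theorem constantMonoid_conj_mem (hcns : E.constantMonoid = MonoidHom.mrange κ)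
    (hκeq : ∀ (σ : Q) (m : O), κ ⟨σ • (m : A), hO σ m m.2⟩ = E.conj σ (κ m)) (σ : Q) {c : E.H}
    (hc : c ∈ E.constantMonoid) : E.conj σ c ∈ E.constantMonoid := by
  rw [hcns] at hc ⊢
  obtain ⟨m, rfl⟩ := hc
  exact ⟨_, hκeq σ m⟩

/-- `M^×_TM` (the units of `Ψ_cns`, record axiom `units_eq`) is conjugation-stable. [cite: Mochizuki2012, Prop 3.1 (ii) p.88] -/
theorem units_conj_mem (hcns : E.constantMonoid = MonoidHom.mrange κ)
    (hκeq : ∀ (σ : Q) (m : O), κ ⟨σ • (m : A), hO σ m m.2⟩ = E.conj σ (κ m)) (σ : Q) :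
    ∀ u ∈ E.units, E.conj σ u ∈ E.units := by
  intro u hu
  rw [E.units_eq] at hu ⊢
  refine ⟨constantMonoid_conj_mem E O hO κ hcns hκeq σ hu.1, ?_⟩
  rw [← map_inv]
  exact constantMonoid_conj_mem E O hO κ hcns hκeq σ hu.2

/-- Two elements of `Π` differing by an element acting TRIVIALLY on `O` (e.g. by an element of the geometric
fundamental group) act identically on `Ψ_cns` (Rmk 3.5.2 (iii)). [cite: Mochizuki2012, Rmk 3.5.2 p.98] -/
theorem conj_eq_of_inv_mul_smul (hcns : E.constantMonoid = MonoidHom.mrange κ)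
    (hκeq : ∀ (σ : Q) (m : O), κ ⟨σ • (m : A), hO σ m m.2⟩ = E.conj σ (κ m)) {x x' : Q}
    (hxx' : ∀ a ∈ O, (x⁻¹ * x') • a = a) {c : E.H} (hc : c ∈ E.constantMonoid) : E.conj x c = E.conj x' c := by
  rw [hcns] at hc
  obtain ⟨m, rfl⟩ := hc
  rw [← hκeq, ← hκeq]
  congr 1
  apply Subtype.ext
  change x • (m : A) = x' • (m : A)
  conv_rhs => rw [show x' = x * (x⁻¹ * x') by group, mul_smul, hxx' _ m.2]

variable {G : Type*} [Group G] {T : Type*}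

/-- **Conjugate synchronization of the constants** (Cor 3.5 (i)(ii), Rmk 3.5.2 (iii)): sections `s_t : G_v → Π`
agreeing modulo a subgroup `Δ` that acts trivially on `O` act label-independently on `M^×_TM ⊆ Ψ_cns`.
[cite: Mochizuki2012, Cor 3.5 (ii) p.94] -/
theorem sync_units_of_sections_kummer (hcns : E.constantMonoid = MonoidHom.mrange κ)
    (hκeq : ∀ (σ : Q) (m : O), κ ⟨σ • (m : A), hO σ m m.2⟩ = E.conj σ (κ m)) (Δ : Subgroup Q)
    (hΔ : ∀ δ ∈ Δ, ∀ a ∈ O, δ • a = a) (s : T → (G →* Q))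
    (hs : ∀ t t' g, (QuotientGroup.mk (s t g) : Q ⧸ Δ) = QuotientGroup.mk (s t' g)) :
    ∀ g t t', ∀ u ∈ E.units, E.conj (s t g) u = E.conj (s t' g) u :=
  fun g t t' _ hu => conj_eq_of_inv_mul_smul E O hO κ hcns hκeq
    (fun a ha => hΔ _ (QuotientGroup.eq.mp (hs t t' g)) a ha) (units_le_constantMonoid E hu)

variable {M : Type*} [CommMonoid M]

/-- **IUTchII:Cor3.5(ii)** (kurims p.95) "each `Ψ_ξ(M^Θ_*)` is equipped with a natural action by `G_v(M^Θ_*▶)_{⟨F_l^⋇⟩}`" —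
restrictions OUT OF THE THETA MONOID `M^×_TM · θ^ℕ` — **from the Kummer map of a `Π`-module of constants** (no [AbsTopIII]
interface): conjugate synchronization of the constants and stability of the units DERIVED from the Kummer action data;
remaining junction hypotheses as in the landed family: `hs` (sections agree modulo a `Δ` acting trivially on `O`), `hfix`,
`hr`. [cite: Mochizuki2012, Cor 3.5 (ii) p.95] -/
theorem mrange_pi_diagonalStable'_ofKummerAction (hcns : E.constantMonoid = MonoidHom.mrange κ)
    (hκeq : ∀ (σ : Q) (m : O), κ ⟨σ • (m : A), hO σ m m.2⟩ = E.conj σ (κ m)) (Δ : Subgroup Q)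
    (hΔ : ∀ δ ∈ Δ, ∀ a ∈ O, δ • a = a) (s : T → (G →* Q))
    (hs : ∀ t t' g, (QuotientGroup.mk (s t g) : Q ⧸ Δ) = QuotientGroup.mk (s t' g))
    (β : G →* MulAut M) (θ : E.H) (hfix : ∀ g t, E.conj (s t g) θ = θ)
    (hstab : ∀ g t, ∀ x ∈ splitMonoid E.units (Submonoid.powers θ),
      E.conj (s t g) x ∈ splitMonoid E.units (Submonoid.powers θ))
    (r : T → (splitMonoid E.units (Submonoid.powers θ) →* M))
    (hr : ∀ t g (x : splitMonoid E.units (Submonoid.powers θ)), r t ⟨E.conj (s t g) x, hstab g t x x.2⟩ = β g (r t x))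
    (t₀ : T) (g : G) :
    (MonoidHom.mrange (MonoidHom.pi r)).map (piIso T (β g)).toMonoidHom = MonoidHom.mrange (MonoidHom.pi r) :=
  mrange_pi_diagonalStable_submonoid E.conj s β _ hstab r hr
    (sync_splitMonoid E.conj s E.units θ (sync_units_of_sections_kummer E O hO κ hcns hκeq Δ hΔ s hs)
      (fun g t t' => by rw [hfix, hfix])) t₀ g

/-- The stability hypothesis `hstab` of `mrange_pi_diagonalStable'_ofKummerAction` HOLDS: `M^×_TM · θ^ℕ` is stable under
the `s_t(g)` (units by the Kummer action, `θ` by `hfix`). [cite: Mochizuki2012, Cor 3.5 (ii) p.95] -/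
theorem thetaSplit_conjStable_ofKummerAction (hcns : E.constantMonoid = MonoidHom.mrange κ)
    (hκeq : ∀ (σ : Q) (m : O), κ ⟨σ • (m : A), hO σ m m.2⟩ = E.conj σ (κ m)) (s : T → (G →* Q)) (θ : E.H)
    (hfix : ∀ g t, E.conj (s t g) θ = θ) (g : G) (t : T) :
    ∀ x ∈ splitMonoid E.units (Submonoid.powers θ), E.conj (s t g) x ∈ splitMonoid E.units (Submonoid.powers θ) :=
  fun x hx => splitMonoid_conjStable E.conj E.units θ (s t g) (units_conj_mem E O hO κ hcns hκeq (s t g))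
    ⟨1, E.units.one_mem, by rw [hfix, one_mul]⟩ x hx

end KummerAction

/-! ### 2. At the label-wise cohomology model -/

section Labelwise

variable {Q : Type u} [Group Q] (E : TemperedThetaMonoids.ThetaEnvData.{u, v} Q)
  {A : Type w} [CommGroup A] [MulDistribMulAction Q A] (O : Submonoid A)
  (hO : ∀ (σ : Q) (b : A), b ∈ O → σ • b ∈ O) (κ : O →* E.H)
  {P₀ P : TopGroup.{u}} {G' : Type u} [Group G'] [TopologicalSpace G'] [IsTopologicalGroup G']
  (φ : P →* G') (φ₀ : P₀ →* G') (Am : Subgroup G') [Am.Normal] [IsMulCommutative Am] (N : Subgroup P) [N.Normal]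
  (j : Q →* P) (ψ : Additive E.H ≃+ h1Lim φ Am N ⊥) {L : Type*} (s : L → (P₀ →* Q))
  (hι : ∀ t, Continuous (j.comp (s t))) (hN : ∀ t, (⊤ : Subgroup P₀).map (j.comp (s t)) ≤ N)
  (hφ : ∀ t, φ.comp (j.comp (s t)) = φ₀)

/-- **IUTchII:Cor3.5(ii)** (kurims p.95), the Galois clause **at the label-wise cohomology model from the Kummer map of a
`Π`-module of constants**: `hr` and `hfix` discharged (abc-iut-w4-d004 `restriction_conj_section_eq_labelwise`,
`conj_section_eq_self_labelwise`), `hs` from "the `s_t` are sections of an augmentation `q : Π → G` whose kernel acts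
trivially on `O`" (`sections_mk_eq_of_isSection`), conjugate synchronization from the Kummer action. Residual =
Kummer action data (`κ`, `Ψ_cns = κ(O)`, equivariance, `Ker q` trivial on `O`), identification `(j, ψ)`, sections data
(`ι_t = j ∘ s_t` continuous into `Π_Ÿ`, common `φ₀`, `q ∘ s_t = w`), `θ` top-level, restrictions pinned.
[cite: Mochizuki2012, Cor 3.5 (ii) p.95] -/
theorem mrange_pi_diagonalStable'_ofKummerAction_labelwise (hcns : E.constantMonoid = MonoidHom.mrange κ)
    (hκeq : ∀ (σ : Q) (m : O), κ ⟨σ • (m : A), hO σ m m.2⟩ = E.conj σ (κ m))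
    {K : Type*} [Group K] (q : Q →* K) (hq : ∀ x : Q, q x = 1 → ∀ a ∈ O, x • a = a) (w : P₀ →* K)
    (hsec : ∀ t g, q (s t g) = w g)
    (hψ : ∀ (p : Q) (y : E.H),
      ψ (Additive.ofMul (E.conj p y)) = h1LimConj φ Am N (j p) (ψ (Additive.ofMul y)))
    (θ : E.H) (hθ : ψ (Additive.ofMul θ) ∈ Set.range ((cohomologySystemOfContH1 φ Am N).toLim ⊤))
    (R : L → (E.H →* Multiplicative (h1Lim φ₀ Am (⊤ : Subgroup P₀) ⊥)))
    (hR : ∀ t y, Multiplicative.toAdd (R t y) =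
      h1LimCongr Am ⊤ (hφ t) ⊥ (h1LimComap φ Am (j.comp (s t)) (hι t) (hN t) (ψ (Additive.ofMul y))))
    (t₀ : L) (g : P₀) :
    (MonoidHom.mrange (MonoidHom.pi fun t =>
        (R t).comp (splitMonoid E.units (Submonoid.powers θ)).subtype)).map
        (piIso L (h1LimConjMulAut φ₀ Am ⊤ g)).toMonoidHom =
      MonoidHom.mrange (MonoidHom.pi fun t => (R t).comp (splitMonoid E.units (Submonoid.powers θ)).subtype) := by
  have hfix : ∀ g t, E.conj (s t g) θ = θ := conj_section_eq_self_labelwise E φ Am N j ψ s hN hψ hθ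
  exact mrange_pi_diagonalStable'_ofKummerAction E O hO κ hcns hκeq q.ker
    (fun δ hδ a ha => hq δ (MonoidHom.mem_ker.mp hδ) a ha) s
    (sections_mk_eq_of_isSection s q q.ker (fun x hx => MonoidHom.mem_ker.mpr hx) w hsec)
    (h1LimConjMulAut φ₀ Am ⊤) θ hfix (thetaSplit_conjStable_ofKummerAction E O hO κ hcns hκeq s θ hfix) _
    (fun t g' x => restriction_conj_section_eq_labelwise E φ φ₀ Am N j ψ s hι hN hφ hψ R hR t g' (x : E.H)) t₀ g

end Labelwise

end BadPrimeGaussianMonoids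

end Literature.IUT.HodgeArakelov
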